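import Mathlib

/-!
# The state-level layer cake — the algebra behind row 2′DARC at an OR-tail with two incomparable
uncovered entries in the HEAD-AWARE case (blind cell PercRepro2, night-2 g13;
proofs/NIGHT2-DARC.md §48)

Four ENTRY STATES `e ∈ {0, 1, 2, 3}` (`0` = no entry present, `1` = `r₁` only, `2` = `r₂` only,
`3` = both; the `2 × 2` lattice `0 < 1, 2 < 3`).  For each state the `R`-law has mass `l_e` and the
gate law has mass `n_e` (`n₀ = l₀`: the gate agrees with the `R`-law on the entry-free clusters),
and `u_e, w_e` are the two marker-mean shifts of the state's gate law against the GLOBAL `R`-law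
means.  The cleared functional is `Λ²·Σ_e [C_e / n_e + n_e u_e w_e]` with `C_e ≥ 0` the within-state
marker covariances of the gate law (FKG on each state); what remains is
`Σ_e n_e u_e w_e ≥ 0`.  With `O = u₀w₀`, `X = u₁w₁`, `Y = u₂w₂`, `Z = u₃w₃` this is the LAYER CAKE of
the ratios `r_e = n_e / l_e` (`r₀ = 1 ≥ r₃ ≥ r₁, r₂`) over the state lattice: for `r₁ ≤ r₂`,

`l₁l₂l₃ · (l₀O + n₁X + n₂Y + n₃Z) = (l₁ − n₁)l₂l₃ · l₀O + n₁l₂l₃ · SE + (n₂l₁ − n₁l₂)l₃ · S2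
  + (n₃l₂ − n₂l₃)l₁l₃ · Z`

(`stateLayer_main`), where `SE = Σ_e l_e u_e w_e ≥ 0` is FKG on the whole state lattice
(`fkg22_nonneg`: `l` log-supermodular, `u, w` increasing with nonnegative `l`-means) and
`S2 = l₂Y + l₃Z ≥ 0` is Chebyshev on the chain `{2 < 3}` (`chain2_nonneg`); `O ≥ 0` (both shifts of
the ideal state are `≤ 0`) and `Z ≥ 0` (both shifts of the top state are `≥ 0`).  The degenerate
masses are handled in `stateLayer_nonneg`.  Pure algebra, Mathlib only.
-/

namespace Summit.Ventures.PercRepro2.Coin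

section StateLayer

variable {R : Type*} [Field R] [LinearOrder R] [IsStrictOrderedRing R]

/-- **Chebyshev on the two-point chain** `{1 < 3}` (weighted form): weights `l₁, l₃ ≥ 0`, the pair
`(u, w)` similarly ordered along the chain, both weighted means nonnegative. -/
theorem chain2_nonneg (l₁ l₃ u₁ u₃ w₁ w₃ : R) (h1 : 0 ≤ l₁) (h3 : 0 ≤ l₃)
    (hmono : 0 ≤ l₁ * l₃ * ((u₃ - u₁) * (w₃ - w₁)))
    (hmu : 0 ≤ l₁ * u₁ + l₃ * u₃) (hmw : 0 ≤ l₁ * w₁ + l₃ * w₃) :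
    0 ≤ l₁ * (u₁ * w₁) + l₃ * (u₃ * w₃) := by
  have key : (l₁ + l₃) * (l₁ * (u₁ * w₁) + l₃ * (u₃ * w₃)) =
      (l₁ * u₁ + l₃ * u₃) * (l₁ * w₁ + l₃ * w₃) + l₁ * l₃ * ((u₃ - u₁) * (w₃ - w₁)) := by ring
  rcases (add_nonneg h1 h3).eq_or_lt with h | h
  · have e1 : l₁ = 0 := by linarith
    have e3 : l₃ = 0 := by linarith
    subst e1 e3
    simp
  · have hprod : 0 ≤ (l₁ + l₃) * (l₁ * (u₁ * w₁) + l₃ * (u₃ * w₃)) := by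
      rw [key]
      exact add_nonneg (mul_nonneg hmu hmw) hmono
    exact (mul_nonneg_iff_of_pos_left h).1 hprod

/-- The incomparable pair `{1, 2}` of the state lattice is dominated by the pair `{0, 3}`: for
`u, w` increasing on `0 < 1, 2 < 3` and `l₁l₂ ≤ l₀l₃`. -/
theorem pair_cross_nonneg (l₀ l₁ l₂ l₃ u₀ u₁ u₂ u₃ w₀ w₁ w₂ w₃ : R)
    (h0 : 0 ≤ l₀) (h1 : 0 ≤ l₁) (h2 : 0 ≤ l₂) (h3 : 0 ≤ l₃) (hlsm : l₁ * l₂ ≤ l₀ * l₃)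
    (hu01 : u₀ ≤ u₁) (hu02 : u₀ ≤ u₂) (hu13 : u₁ ≤ u₃) (hu23 : u₂ ≤ u₃)
    (hw01 : w₀ ≤ w₁) (hw02 : w₀ ≤ w₂) (hw13 : w₁ ≤ w₃) (hw23 : w₂ ≤ w₃) :
    0 ≤ l₀ * l₃ * ((u₃ - u₀) * (w₃ - w₀)) + l₁ * l₂ * ((u₁ - u₂) * (w₁ - w₂)) := by
  have hA : 0 ≤ l₀ * l₃ * ((u₃ - u₀) * (w₃ - w₀)) :=
    mul_nonneg (mul_nonneg h0 h3) (mul_nonneg (by linarith) (by linarith))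
  have hC : l₁ * l₂ * ((u₃ - u₀) * (w₃ - w₀)) ≤ l₀ * l₃ * ((u₃ - u₀) * (w₃ - w₀)) :=
    mul_le_mul_of_nonneg_right hlsm (mul_nonneg (by linarith) (by linarith))
  rcases le_total u₁ u₂ with hu | hu <;> rcases le_total w₁ w₂ with hw | hw
  · -- both differences `≤ 0`: the second term is nonnegative
    have : 0 ≤ (u₁ - u₂) * (w₁ - w₂) :=
      mul_nonneg_of_nonpos_of_nonpos (by linarith) (by linarith)
    exact add_nonneg hA (mul_nonneg (mul_nonneg h1 h2) this)
  · -- `u₁ ≤ u₂`, `w₂ ≤ w₁`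
    have hp : (u₂ - u₁) * (w₁ - w₂) ≤ (u₃ - u₀) * (w₃ - w₀) :=
      mul_le_mul (by linarith) (by linarith) (by linarith) (by linarith)
    have hB : l₁ * l₂ * ((u₂ - u₁) * (w₁ - w₂)) ≤ l₁ * l₂ * ((u₃ - u₀) * (w₃ - w₀)) :=
      mul_le_mul_of_nonneg_left hp (mul_nonneg h1 h2)
    have e : l₁ * l₂ * ((u₁ - u₂) * (w₁ - w₂)) = -(l₁ * l₂ * ((u₂ - u₁) * (w₁ - w₂))) := by ring
    linarith
  · -- `u₂ ≤ u₁`, `w₁ ≤ w₂`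
    have hp : (u₁ - u₂) * (w₂ - w₁) ≤ (u₃ - u₀) * (w₃ - w₀) :=
      mul_le_mul (by linarith) (by linarith) (by linarith) (by linarith)
    have hB : l₁ * l₂ * ((u₁ - u₂) * (w₂ - w₁)) ≤ l₁ * l₂ * ((u₃ - u₀) * (w₃ - w₀)) :=
      mul_le_mul_of_nonneg_left hp (mul_nonneg h1 h2)
    have e : l₁ * l₂ * ((u₁ - u₂) * (w₁ - w₂)) = -(l₁ * l₂ * ((u₁ - u₂) * (w₂ - w₁))) := by ring
    linarith
  · -- both differences `≥ 0`
    have : 0 ≤ (u₁ - u₂) * (w₁ - w₂) := mul_nonneg (by linarith) (by linarith)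
    exact add_nonneg hA (mul_nonneg (mul_nonneg h1 h2) this)

/-- **FKG on the `2 × 2` state lattice** `0 < 1, 2 < 3` (weighted form): log-supermodular weights,
the five comparable pairs similarly ordered, the incomparable pair dominated by the extreme pair,
both weighted means nonnegative ⟹ the weighted sum of the products is nonnegative. -/
theorem fkg22_nonneg (l₀ l₁ l₂ l₃ u₀ u₁ u₂ u₃ w₀ w₁ w₂ w₃ : R)
    (h0 : 0 ≤ l₀) (h1 : 0 ≤ l₁) (h2 : 0 ≤ l₂) (h3 : 0 ≤ l₃)
    (h01 : 0 ≤ l₀ * l₁ * ((u₁ - u₀) * (w₁ - w₀)))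
    (h02 : 0 ≤ l₀ * l₂ * ((u₂ - u₀) * (w₂ - w₀)))
    (h13 : 0 ≤ l₁ * l₃ * ((u₃ - u₁) * (w₃ - w₁)))
    (h23 : 0 ≤ l₂ * l₃ * ((u₃ - u₂) * (w₃ - w₂)))
    (hcross : 0 ≤ l₀ * l₃ * ((u₃ - u₀) * (w₃ - w₀)) + l₁ * l₂ * ((u₁ - u₂) * (w₁ - w₂)))
    (hmu : 0 ≤ l₀ * u₀ + l₁ * u₁ + l₂ * u₂ + l₃ * u₃)
    (hmw : 0 ≤ l₀ * w₀ + l₁ * w₁ + l₂ * w₂ + l₃ * w₃) :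
    0 ≤ l₀ * (u₀ * w₀) + l₁ * (u₁ * w₁) + l₂ * (u₂ * w₂) + l₃ * (u₃ * w₃) := by
  have key : (l₀ + l₁ + l₂ + l₃) *
      (l₀ * (u₀ * w₀) + l₁ * (u₁ * w₁) + l₂ * (u₂ * w₂) + l₃ * (u₃ * w₃)) =
      (l₀ * u₀ + l₁ * u₁ + l₂ * u₂ + l₃ * u₃) * (l₀ * w₀ + l₁ * w₁ + l₂ * w₂ + l₃ * w₃)
      + l₀ * l₁ * ((u₁ - u₀) * (w₁ - w₀)) + l₀ * l₂ * ((u₂ - u₀) * (w₂ - w₀))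
      + l₁ * l₃ * ((u₃ - u₁) * (w₃ - w₁)) + l₂ * l₃ * ((u₃ - u₂) * (w₃ - w₂))
      + (l₀ * l₃ * ((u₃ - u₀) * (w₃ - w₀)) + l₁ * l₂ * ((u₁ - u₂) * (w₁ - w₂))) := by ring
  have hL : 0 ≤ l₀ + l₁ + l₂ + l₃ := by linarith
  rcases hL.eq_or_lt with h | h
  · have e0 : l₀ = 0 := by linarith
    have e1 : l₁ = 0 := by linarith
    have e2 : l₂ = 0 := by linarith
    have e3 : l₃ = 0 := by linarith
    subst e0 e1 e2 e3
    simp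
  · have hprod : 0 ≤ (l₀ + l₁ + l₂ + l₃) *
        (l₀ * (u₀ * w₀) + l₁ * (u₁ * w₁) + l₂ * (u₂ * w₂) + l₃ * (u₃ * w₃)) := by
      rw [key]
      have := mul_nonneg hmu hmw
      linarith
    exact (mul_nonneg_iff_of_pos_left h).1 hprod

/-- **The layer cake, main case** (`r₁ ≤ r₂`, all three entered states of positive `R`-mass). -/
theorem stateLayer_main (l₀ l₁ l₂ l₃ n₁ n₂ n₃ O X Y Z : R)
    (hl₀ : 0 ≤ l₀) (hl₂ : 0 ≤ l₂) (hl₃ : 0 ≤ l₃) (hn₁ : 0 ≤ n₁) (hn₂ : 0 ≤ n₂)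
    (hn₁l : n₁ ≤ l₁) (hr₂ : n₂ * l₃ ≤ l₂ * n₃) (hcase : n₁ * l₂ ≤ n₂ * l₁)
    (hO : 0 ≤ O) (hZ : 0 ≤ Z) (hS2 : 0 < n₂ → 0 ≤ l₂ * Y + l₃ * Z)
    (hSE : 0 < n₁ → 0 < n₂ → 0 ≤ l₀ * O + l₁ * X + l₂ * Y + l₃ * Z)
    (hpos : 0 < l₁ * l₂ * l₃) :
    0 ≤ l₀ * O + n₁ * X + n₂ * Y + n₃ * Z := by
  have hl₁ : 0 < l₁ := by
    rcases (le_or_gt l₁ 0) with h | h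
    · exfalso
      have : l₁ * l₂ * l₃ ≤ 0 := mul_nonpos_of_nonpos_of_nonneg (mul_nonpos_of_nonpos_of_nonneg h hl₂) hl₃
      linarith
    · exact h
  have hl₂' : 0 < l₂ := by
    rcases (le_or_gt l₂ 0) with h | h
    · exfalso
      have : l₁ * l₂ * l₃ ≤ 0 :=
        mul_nonpos_of_nonpos_of_nonneg (mul_nonpos_of_nonneg_of_nonpos hl₁.le h) hl₃
      linarith
    · exact h
  have key : l₁ * l₂ * l₃ * (l₀ * O + n₁ * X + n₂ * Y + n₃ * Z) =
      (l₁ - n₁) * l₂ * l₃ * (l₀ * O) + n₁ * l₂ * l₃ * (l₀ * O + l₁ * X + l₂ * Y + l₃ * Z)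
      + (n₂ * l₁ - n₁ * l₂) * l₃ * (l₂ * Y + l₃ * Z) + (n₃ * l₂ - n₂ * l₃) * l₁ * l₃ * Z := by ring
  have t1 : 0 ≤ (l₁ - n₁) * l₂ * l₃ * (l₀ * O) :=
    mul_nonneg (mul_nonneg (mul_nonneg (by linarith) hl₂) hl₃) (mul_nonneg hl₀ hO)
  have t2 : 0 ≤ n₁ * l₂ * l₃ * (l₀ * O + l₁ * X + l₂ * Y + l₃ * Z) := by
    rcases hn₁.eq_or_lt with h | h
    · rw [← h]; simp
    · have hn₂' : 0 < n₂ := by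
        rcases hn₂.eq_or_lt with h2 | h2
        · exfalso
          rw [← h2] at hcase
          have : 0 < n₁ * l₂ := mul_pos h hl₂'
          linarith
        · exact h2
      exact mul_nonneg (mul_nonneg (mul_nonneg hn₁ hl₂) hl₃) (hSE h hn₂')
  have t3 : 0 ≤ (n₂ * l₁ - n₁ * l₂) * l₃ * (l₂ * Y + l₃ * Z) := by
    rcases hn₂.eq_or_lt with h | h
    · have : n₁ * l₂ ≤ 0 := by rw [← h] at hcase; simpa using hcase
      have hn₁0 : n₁ = 0 := by
        rcases hn₁.eq_or_lt with h1 | h1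
        · exact h1.symm
        · exfalso; have := mul_pos h1 hl₂'; linarith
      rw [← h, hn₁0]; simp
    · exact mul_nonneg (mul_nonneg (by linarith) hl₃) (hS2 h)
  have t4 : 0 ≤ (n₃ * l₂ - n₂ * l₃) * l₁ * l₃ * Z :=
    mul_nonneg (mul_nonneg (mul_nonneg (by linarith) hl₁.le) hl₃) hZ
  have hprod : 0 ≤ l₁ * l₂ * l₃ * (l₀ * O + n₁ * X + n₂ * Y + n₃ * Z) := by
    rw [key]; linarith
  exact (mul_nonneg_iff_of_pos_left hpos).1 hprod

/-- **THE STATE-LEVEL LAYER CAKE.** Masses `l_e ≥ 0` of the `R`-law and `n_e ≥ 0` of the gate on the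
four entry states (`n₀ = l₀`), `n_e ≤ l_e`, the ratios `n_e / l_e` of the singly-entered states below
that of the doubly-entered one; the products `O, Z` of
the ideal / top state nonnegative and the chain / lattice sums `S1, S2, SE` nonnegative (each only
needed when the corresponding gate masses are positive) ⟹ `l₀O + n₁X + n₂Y + n₃Z ≥ 0`. -/
theorem stateLayer_nonneg (l₀ l₁ l₂ l₃ n₁ n₂ n₃ O X Y Z : R)
    (hl₀ : 0 ≤ l₀) (hl₁ : 0 ≤ l₁) (hl₂ : 0 ≤ l₂) (hl₃ : 0 ≤ l₃)
    (hn₁ : 0 ≤ n₁) (hn₂ : 0 ≤ n₂) (hn₃ : 0 ≤ n₃)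
    (hn₁l : n₁ ≤ l₁) (hn₂l : n₂ ≤ l₂) (hn₃l : n₃ ≤ l₃)
    (hr₁ : n₁ * l₃ ≤ l₁ * n₃) (hr₂ : n₂ * l₃ ≤ l₂ * n₃)
    (hO : 0 ≤ O) (hZ : 0 ≤ Z)
    (hS1 : 0 < n₁ → 0 ≤ l₁ * X + l₃ * Z) (hS2 : 0 < n₂ → 0 ≤ l₂ * Y + l₃ * Z)
    (hSE : 0 < n₁ → 0 < n₂ → 0 ≤ l₀ * O + l₁ * X + l₂ * Y + l₃ * Z) :
    0 ≤ l₀ * O + n₁ * X + n₂ * Y + n₃ * Z := by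
  have hl₀O : 0 ≤ l₀ * O := mul_nonneg hl₀ hO
  have hn₃Z : 0 ≤ n₃ * Z := mul_nonneg hn₃ hZ
  -- a singly-entered state of positive gate mass with `l₃ = 0` has `X ≥ 0` (resp. `Y ≥ 0`)
  have aux : ∀ (l n X' : R), 0 ≤ l → 0 ≤ n → n ≤ l → l₃ = 0 →
      (0 < n → 0 ≤ l * X' + l₃ * Z) → 0 ≤ n * X' := by
    intro l n X' hl hn hnl h3 hS
    rcases hn.eq_or_lt with h | h
    · rw [← h]; simp
    · have hl' : 0 < l := lt_of_lt_of_le h hnl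
      have := hS h
      rw [h3, zero_mul, add_zero] at this
      have hX : 0 ≤ X' := (mul_nonneg_iff_of_pos_left hl').1 this
      exact mul_nonneg hn hX
  rcases hl₃.eq_or_lt with h3 | h3
  · -- `l₃ = 0`: then `n₃ = 0`, and `l₁ = 0` or `l₂ = 0`
    have hn₃0 : n₃ = 0 := le_antisymm (h3 ▸ hn₃l) hn₃
    have hX : 0 ≤ n₁ * X := aux l₁ n₁ X hl₁ hn₁ hn₁l h3.symm hS1
    have hY : 0 ≤ n₂ * Y := aux l₂ n₂ Y hl₂ hn₂ hn₂l h3.symm hS2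
    rw [hn₃0]; linarith
  · -- `l₃ > 0`
    rcases hl₁.eq_or_lt with h1 | h1
    · -- `l₁ = 0`, hence `n₁ = 0`
      have hn₁0 : n₁ = 0 := le_antisymm (h1 ▸ hn₁l) hn₁
      rw [hn₁0, zero_mul, add_zero]
      rcases hn₂.eq_or_lt with h2 | h2
      · rw [← h2]; simp; linarith
      · have hS := hS2 h2
        -- `l₃ (n₂ Y + n₃ Z) ≥ 0`
        have hkey : 0 ≤ l₃ * (n₂ * Y + n₃ * Z) := by
          rcases le_or_gt 0 Y with hY | hY
          · exact mul_nonneg h3.le (add_nonneg (mul_nonneg hn₂ hY) hn₃Z)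
          · have e1 : n₂ * l₃ * Y ≥ l₂ * n₃ * Y := by nlinarith
            have e2 : 0 ≤ n₃ * (l₂ * Y + l₃ * Z) := mul_nonneg hn₃ hS
            nlinarith
        have := (mul_nonneg_iff_of_pos_left h3).1 hkey
        linarith
    · rcases hl₂.eq_or_lt with h2 | h2
      · -- `l₂ = 0`, hence `n₂ = 0`
        have hn₂0 : n₂ = 0 := le_antisymm (h2 ▸ hn₂l) hn₂
        rw [hn₂0, zero_mul, add_zero]
        rcases hn₁.eq_or_lt with h1' | h1'
        · rw [← h1']; simp; linarith
        · have hS := hS1 h1'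
          have hkey : 0 ≤ l₃ * (n₁ * X + n₃ * Z) := by
            rcases le_or_gt 0 X with hX | hX
            · exact mul_nonneg h3.le (add_nonneg (mul_nonneg hn₁ hX) hn₃Z)
            · have e1 : n₁ * l₃ * X ≥ l₁ * n₃ * X := by nlinarith
              have e2 : 0 ≤ n₃ * (l₁ * X + l₃ * Z) := mul_nonneg hn₃ hS
              nlinarith
          have := (mul_nonneg_iff_of_pos_left h3).1 hkey
          linarith
      · -- the main case: all three entered states of positive `R`-mass
        have hpos : 0 < l₁ * l₂ * l₃ := mul_pos (mul_pos h1 h2) h3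
        rcases le_total (n₁ * l₂) (n₂ * l₁) with hc | hc
        · exact stateLayer_main l₀ l₁ l₂ l₃ n₁ n₂ n₃ O X Y Z hl₀ hl₂ hl₃ hn₁ hn₂ hn₁l hr₂ hc
            hO hZ hS2 hSE hpos
        · have hpos' : 0 < l₂ * l₁ * l₃ := by rw [mul_comm l₂ l₁]; exact hpos
          have := stateLayer_main l₀ l₂ l₁ l₃ n₂ n₁ n₃ O Y X Z hl₀ hl₁ hl₃ hn₂ hn₁ hn₂l hr₁ hc
            hO hZ hS1 (fun a b => by have := hSE b a; linarith) hpos'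
          linarith

end StateLayer

end Summit.Ventures.PercRepro2.Coin
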